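import Mathlib
import Summits.ValiantsHypothesis.ValiantsHypothesis.Theorems.BarrierLeverPartitionMinorsHitByVPHiddenStatesFullJoinDoorPow
import Summits.ValiantsHypothesis.ValiantsHypothesis.Theorems.BarrierLeverPartitionMinorsHitByVPHiddenStatesFullJoinShell

/-!
# Route BarrierLever — item `PartitionMinorsHitByVP` (stmt-ValiantsHypothesis-19717), line `hidden_states`:
# THE TOP END — every minor with `2^h − 1` rows is hit (`SmallCircuits ℂ (h+h) 6`), by the ONE-SIDED method at the 0/1 table

Helper file (`--supports stmt-ValiantsHypothesis-19717`; cell valiant-natproofs, rung V4, 𝒟-side door (c), line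
`Cruxes/PartitionMinorsHitByVP/Lines/hidden_states.lean` v8; prover seat val-np-p3 gen 16). Definition-free. Closes NO item.

THE POINT (memo val-np-p3 g16 «full join» §21). The one-sided universal-design method (p679900/p680177) at its simplest: with `K = h` states, the
design «all state sets except the top one» (`2^h − 1` sets, a strict threshold family for unit weights) and the 0/1 table with base row 1, the
row family of ANY injective `u : Fin (2^h − 1) → Finset (Fin h)` gives the matrix `[2^{|u i ∩ J k|}]`, a maximal proper minor of the Kronecker power
`F = [2^{|U ∩ J|}]_{U,J} = ⊗^h [[1,1],[1,2]]`, whose inverse `G[J,U] = ∏_a g(a∈J, a∈U)` (`g = [[2,−1],[−1,1]]`) has NO zero entry in the row `J = univ`;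
by the adjugate formula every such minor is nonzero (`topDesign_good`). Rows and columns use the same design, so by
`fullJoin_det_ne_zero_of_threshold` and the free-exponent door (e = 1): for every `h ≥ 3` and EVERY pair of injective families of `2^h − 1`
subsets, some `f ∈ SmallCircuits ℂ (h + h) 6` has a nonsingular partition matrix on it (`partitionMinor_hit_of_card_eq_two_pow_sub_one`). With
p680788 (r ≤ h^e + 1) both ends of the range of `r` are now unconditional; the middle is conjecture UTD.

WHAT THIS IS NOT: nothing for `h^e + 1 < r < 2^h − 1`; item 19717 stays OPEN; nothing on crux 14610 or VP ≠ VNP.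
-/

set_option linter.dupNamespace false

namespace Summit.ValiantsHypothesis.ValiantsHypothesis.Theorems.BarrierLever.HiddenStates

open Finset Matrix
open Literature.Barriers.ValiantsHypothesis

noncomputable section

namespace FullJoin

variable {h : ℕ}

/-! ## 1. The Kronecker-power matrix `F[U,J] = 2^{|U ∩ J|}` and its explicit inverse -/

/-- The local inverse entries `g(j, u)`: `g(1,1) = 1`, `g(1,0) = g(0,1) = −1`, `g(0,0) = 2`. -/
theorem kronF_mul_kronG (U U' : Finset (Fin h)) :
    ∑ J : Finset (Fin h), (2 : ℂ) ^ (U ∩ J).card *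
        ∏ a : Fin h, (if a ∈ J then (if a ∈ U' then (1 : ℂ) else -1) else (if a ∈ U' then (-1 : ℂ) else 2)) =
      if U = U' then 1 else 0 := by
  classical
  -- write 2^{|U ∩ J|} as a product over coordinates and factor the sum over `J`
  have hpow : ∀ J : Finset (Fin h), (2 : ℂ) ^ (U ∩ J).card = ∏ a ∈ J, (if a ∈ U then (2 : ℂ) else 1) := by
    intro J
    rw [Finset.prod_ite_mem, Finset.prod_const, Finset.inter_comm]
  have hterm : ∀ J : Finset (Fin h), (2 : ℂ) ^ (U ∩ J).card *
      ∏ a : Fin h, (if a ∈ J then (if a ∈ U' then (1 : ℂ) else -1) else (if a ∈ U' then (-1 : ℂ) else 2)) =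
      (∏ a ∈ J, ((if a ∈ U then (2 : ℂ) else 1) * (if a ∈ U' then (1 : ℂ) else -1))) *
        ∏ a ∈ Finset.univ \ J, (if a ∈ U' then (-1 : ℂ) else 2) := by
    intro J
    have hsplit := (Finset.prod_mul_prod_compl J (fun a : Fin h =>
      if a ∈ J then (if a ∈ U' then (1 : ℂ) else -1) else (if a ∈ U' then (-1 : ℂ) else 2))).symm
    have hJ1 : ∏ a ∈ J, (if a ∈ J then (if a ∈ U' then (1 : ℂ) else -1) else (if a ∈ U' then (-1 : ℂ) else 2)) =
        ∏ a ∈ J, (if a ∈ U' then (1 : ℂ) else -1) := Finset.prod_congr rfl fun a ha => by rw [if_pos ha]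
    have hJ0 : ∏ a ∈ Jᶜ, (if a ∈ J then (if a ∈ U' then (1 : ℂ) else -1) else (if a ∈ U' then (-1 : ℂ) else 2)) =
        ∏ a ∈ Finset.univ \ J, (if a ∈ U' then (-1 : ℂ) else 2) := by
      rw [Finset.compl_eq_univ_sdiff]
      exact Finset.prod_congr rfl fun a ha => by rw [if_neg (Finset.mem_sdiff.mp ha).2]
    rw [hpow J, hsplit, hJ1, hJ0, ← mul_assoc, ← Finset.prod_mul_distrib]
  simp_rw [hterm]
  rw [← Finset.powerset_univ, ← Finset.prod_add]
  -- each coordinate contributes `[a ∈ U ↔ a ∈ U']`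
  have hfac : ∀ a : Fin h, ((if a ∈ U then (2 : ℂ) else 1) * (if a ∈ U' then (1 : ℂ) else -1) + (if a ∈ U' then (-1 : ℂ) else 2)) =
      if (a ∈ U ↔ a ∈ U') then 1 else 0 := by
    intro a
    by_cases h1 : a ∈ U <;> by_cases h2 : a ∈ U' <;> simp [h1, h2] <;> norm_num
  simp_rw [hfac]
  by_cases hUU : U = U'
  · subst hUU
    rw [if_pos rfl]
    exact Finset.prod_eq_one fun a _ => by simp
  · rw [if_neg hUU]
    have : ∃ a, ¬ (a ∈ U ↔ a ∈ U') := by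
      by_contra hcon
      push Not at hcon
      exact hUU (Finset.ext fun a => hcon a)
    obtain ⟨a, ha⟩ := this
    exact Finset.prod_eq_zero (Finset.mem_univ a) (by rw [if_neg ha])

/-- **The top design is good for every row family (one-sided, 0/1 table).** For any injective `u : Fin r → Finset (Fin h)` missing exactly one
set and any injective enumeration `J` of all state sets except `univ`, `det[2^{|u i ∩ J k|}] ≠ 0`. -/
theorem topDesign_good {r : ℕ} (u J : Fin r → Finset (Fin h)) (hu : Function.Injective u) (hJ : Function.Injective J)
    (U₀ : Finset (Fin h)) (hU₀ : U₀ ∉ Set.range u) (hur : ∀ U, U ≠ U₀ → U ∈ Set.range u)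
    (hJu : Finset.univ ∉ Set.range J) (hJr : ∀ T, T ≠ Finset.univ → T ∈ Set.range J) :
    (Matrix.of fun i k : Fin r => (2 : ℂ) ^ (u i ∩ J k).card).det ≠ 0 := by
  classical
  -- extend `u` and `J` to bijections `Fin (r+1) ≃ Finset (Fin h)`
  let fR : Fin (r + 1) → Finset (Fin h) := Fin.lastCases U₀ u
  let fC : Fin (r + 1) → Finset (Fin h) := Fin.lastCases Finset.univ J
  have hfR_inj : Function.Injective fR := by
    intro i j hij
    induction i using Fin.lastCases with
    | last =>
      induction j using Fin.lastCases with
      | last => rfl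
      | cast j => exact absurd ⟨j, by simpa [fR] using hij.symm⟩ hU₀
    | cast i =>
      induction j using Fin.lastCases with
      | last => exact absurd ⟨i, by simpa [fR] using hij⟩ hU₀
      | cast j => simpa [fR] using congrArg Fin.castSucc (hu (by simpa [fR] using hij))
  have hfC_inj : Function.Injective fC := by
    intro i j hij
    induction i using Fin.lastCases with
    | last =>
      induction j using Fin.lastCases with
      | last => rfl
      | cast j => exact absurd ⟨j, by simpa [fC] using hij.symm⟩ hJu
    | cast i =>
      induction j using Fin.lastCases with
      | last => exact absurd ⟨i, by simpa [fC] using hij⟩ hJu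
      | cast j => simpa [fC] using congrArg Fin.castSucc (hJ (by simpa [fC] using hij))
  have hfR_surj : Function.Surjective fR := by
    intro U
    by_cases hU : U = U₀
    · exact ⟨Fin.last r, by simp [fR, hU]⟩
    · obtain ⟨i, hi⟩ := hur U hU
      exact ⟨Fin.castSucc i, by simp [fR, hi]⟩
  have hfC_surj : Function.Surjective fC := by
    intro T
    by_cases hT : T = Finset.univ
    · exact ⟨Fin.last r, by simp [fC, hT]⟩
    · obtain ⟨k, hk⟩ := hJr T hT
      exact ⟨Fin.castSucc k, by simp [fC, hk]⟩
  let eR : Fin (r + 1) ≃ Finset (Fin h) := Equiv.ofBijective fR ⟨hfR_inj, hfR_surj⟩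
  let eC : Fin (r + 1) ≃ Finset (Fin h) := Equiv.ofBijective fC ⟨hfC_inj, hfC_surj⟩
  -- the big matrices
  let F : Matrix (Finset (Fin h)) (Finset (Fin h)) ℂ := Matrix.of fun U T => (2 : ℂ) ^ (U ∩ T).card
  let G : Matrix (Finset (Fin h)) (Finset (Fin h)) ℂ := Matrix.of fun T U' =>
    ∏ a : Fin h, (if a ∈ T then (if a ∈ U' then (1 : ℂ) else -1) else (if a ∈ U' then (-1 : ℂ) else 2))
  have hFG : F * G = 1 := by
    ext U U'
    rw [Matrix.mul_apply, Matrix.one_apply]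
    simp only [F, G, Matrix.of_apply]
    exact kronF_mul_kronG U U'
  let F' : Matrix (Fin (r + 1)) (Fin (r + 1)) ℂ := F.submatrix eR eC
  let G' : Matrix (Fin (r + 1)) (Fin (r + 1)) ℂ := G.submatrix eC eR
  have hFG' : F' * G' = 1 := by
    have : F' * G' = (F * G).submatrix eR eR := Matrix.submatrix_mul_equiv F G eR eC eR
    rw [this, hFG, Matrix.submatrix_one_equiv]
  have hdetF' : F'.det ≠ 0 := by
    intro h0
    have := congrArg Matrix.det hFG'
    rw [Matrix.det_mul, h0, zero_mul, Matrix.det_one] at this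
    exact zero_ne_one this
  -- adjugate entry (last, last)
  have hadj : F'.adjugate = F'.det • G' := by
    calc F'.adjugate = F'.adjugate * (F' * G') := by rw [hFG', Matrix.mul_one]
      _ = (F'.adjugate * F') * G' := by rw [Matrix.mul_assoc]
      _ = F'.det • G' := by rw [Matrix.adjugate_mul, Matrix.smul_mul, Matrix.one_mul]
  have hentry : F'.adjugate (Fin.last r) (Fin.last r) = F'.det * G Finset.univ U₀ := by
    rw [hadj, Matrix.smul_apply, smul_eq_mul]
    simp [G', eR, eC, fR, fC, Matrix.submatrix_apply]
  have hGne : G Finset.univ U₀ ≠ 0 := by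
    simp only [G, Matrix.of_apply, Finset.mem_univ, if_true]
    exact Finset.prod_ne_zero_iff.mpr fun a _ => by by_cases ha : a ∈ U₀ <;> simp [ha]
  have hadj_ne : F'.adjugate (Fin.last r) (Fin.last r) ≠ 0 := by
    rw [hentry]; exact mul_ne_zero hdetF' hGne
  rw [Matrix.adjugate_fin_succ_eq_det_submatrix, Fin.succAbove_last] at hadj_ne
  have hM : F'.submatrix Fin.castSucc Fin.castSucc = Matrix.of fun i k : Fin r => (2 : ℂ) ^ (u i ∩ J k).card := by
    ext i k
    simp [F', F, eR, eC, fR, fC, Matrix.submatrix_apply]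
  rw [hM] at hadj_ne
  exact fun h0 => hadj_ne (by rw [h0, mul_zero])

/-! ## 2. Through the door -/

/-- An injective family indexed by `Fin (2^h − 1)` misses exactly one subset. -/
theorem exists_missing_of_card {r : ℕ} (hr : r + 1 = 2 ^ h) (u : Fin r → Finset (Fin h)) (hu : Function.Injective u) :
    ∃ U₀ : Finset (Fin h), U₀ ∉ Set.range u ∧ ∀ U, U ≠ U₀ → U ∈ Set.range u := by
  classical
  have hcard : (Finset.univ.image u).card = r := by
    rw [Finset.card_image_of_injective _ hu, Finset.card_univ, Fintype.card_fin]
  have hcompl : ((Finset.univ.image u)ᶜ).card = 1 := by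
    rw [Finset.card_compl, hcard, Fintype.card_finset, Fintype.card_fin]
    omega
  obtain ⟨U₀, hU₀⟩ := Finset.card_eq_one.mp hcompl
  refine ⟨U₀, ?_, ?_⟩
  · intro ⟨i, hi⟩
    have : U₀ ∈ (Finset.univ.image u)ᶜ := by rw [hU₀]; exact Finset.mem_singleton_self U₀
    rw [Finset.mem_compl] at this
    exact this (Finset.mem_image.mpr ⟨i, Finset.mem_univ i, hi⟩)
  · intro U hU
    have : U ∉ (Finset.univ.image u)ᶜ := by rw [hU₀, Finset.mem_singleton]; exact hU
    rw [Finset.mem_compl, not_not, Finset.mem_image] at this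
    obtain ⟨i, _, hi⟩ := this
    exact ⟨i, hi⟩

/-- **Every minor with `2^h − 1` rows is hit** (all `h ≥ 3`, all pairs of injective families; `SmallCircuits ℂ (h+h) 6`). -/
theorem partitionMinor_hit_of_card_eq_two_pow_sub_one {r : ℕ} (hh : 3 ≤ h) (hr : r + 1 = 2 ^ h)
    (u w : Fin r → Finset (Fin h)) (hu : Function.Injective u) (hw : Function.Injective w) :
    ∃ f ∈ SmallCircuits ℂ (h + h) 6,
      (Matrix.of fun i j : Fin r => MvPolynomial.coeff
        (∑ a ∈ u i, Finsupp.single (Fin.castAdd h a) 1 +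
          ∑ c ∈ w j, Finsupp.single (Fin.natAdd h c) 1) f).det ≠ 0 := by
  classical
  -- the design: all state sets except `univ`
  obtain ⟨J, hJ, hJrange⟩ := exists_enum ((Finset.univ : Finset (Finset (Fin h))).erase Finset.univ)
  have hcardJ : ((Finset.univ : Finset (Finset (Fin h))).erase Finset.univ).card = r := by
    rw [Finset.card_erase_of_mem (Finset.mem_univ _), Finset.card_univ, Fintype.card_finset, Fintype.card_fin]
    omega
  -- transport the enumeration to `Fin r`
  let J' : Fin r → Finset (Fin h) := fun k => J (Fin.cast hcardJ.symm k)
  have hJ' : Function.Injective J' := fun k k' hkk' => by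
    have := hJ hkk'
    simpa [Fin.cast] using congrArg (Fin.cast hcardJ) this
  have hrangeJ' : Set.range J' = Set.range J := by
    ext T; constructor
    · rintro ⟨k, rfl⟩; exact ⟨_, rfl⟩
    · rintro ⟨k, rfl⟩; exact ⟨Fin.cast hcardJ k, by simp [J']⟩
  have hJu : Finset.univ ∉ Set.range J' := by
    rw [hrangeJ', hJrange]; simp
  have hJr : ∀ T, T ≠ Finset.univ → T ∈ Set.range J' := by
    intro T hT; rw [hrangeJ', hJrange]; simpa using hT
  obtain ⟨U₀, hU₀, hur⟩ := exists_missing_of_card hr u hu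
  obtain ⟨W₀, hW₀, hwr⟩ := exists_missing_of_card hr w hw
  -- one-sided goodness on both sides with the 0/1 table (base row 1)
  let tab : Option (Fin h) → Fin h → ℂ := fun o a => o.elim 1 fun q => if q = a then 1 else 0
  have htab : ∀ (v : Fin r → Finset (Fin h)) (i k : Fin r),
      (∏ a ∈ v i, (tab none a + ∑ q ∈ J' k, tab (some q) a)) = (2 : ℂ) ^ (v i ∩ J' k).card := by
    intro v i k
    have : ∀ a, (tab none a + ∑ q ∈ J' k, tab (some q) a) = if a ∈ J' k then (2 : ℂ) else 1 := by
      intro a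
      simp only [tab, Option.elim]
      rw [Finset.sum_ite_eq' (J' k) a (fun _ => (1 : ℂ))]
      by_cases ha : a ∈ J' k
      · simp [ha]; norm_num
      · simp [ha]
    simp_rw [this]
    rw [Finset.prod_ite_mem, Finset.prod_const]
  have hx : (Matrix.of fun i k : Fin r => ∏ a ∈ u i, (tab none a + ∑ q ∈ J' k, tab (some q) a)).det ≠ 0 := by
    simp_rw [htab u]; exact topDesign_good u J' hu hJ' U₀ hU₀ hur hJu hJr
  have hy : (Matrix.of fun j k : Fin r => ∏ c ∈ w j, (tab none c + ∑ q ∈ J' k, tab (some q) c)).det ≠ 0 := by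
    simp_rw [htab w]; exact topDesign_good w J' hw hJ' W₀ hW₀ hwr hJu hJr
  -- the threshold lemma with one cube and unit weights
  have hthr : ∀ x : Fin 1 × Finset (Fin h), x ∉ Set.range (fun k : Fin r => ((0 : Fin 1), J' k)) →
      ∀ i : Fin r, (fun _ : Fin 1 => (0 : ℕ)) ((fun k : Fin r => ((0 : Fin 1), J' k)) i).1 +
          ∑ q ∈ ((fun k : Fin r => ((0 : Fin 1), J' k)) i).2, (fun (_ : Fin 1) (_ : Fin h) => (1 : ℕ)) ((fun k : Fin r => ((0 : Fin 1), J' k)) i).1 q <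
        (fun _ : Fin 1 => (0 : ℕ)) x.1 + ∑ q ∈ x.2, (fun (_ : Fin 1) (_ : Fin h) => (1 : ℕ)) x.1 q := by
    intro x hx' i
    have hx2 : x.2 = Finset.univ := by
      by_contra hne
      obtain ⟨k, hk⟩ := hJr x.2 hne
      exact hx' ⟨k, by ext <;> simp [Subsingleton.elim x.1 0, hk]⟩
    have hlt : (J' i).card < (Finset.univ : Finset (Fin h)).card := by
      apply Finset.card_lt_card
      refine lt_of_le_of_ne (Finset.subset_univ _) fun h' => hJu ⟨i, h'⟩
    simpa [hx2] using hlt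
  have he : Function.Injective (fun k : Fin r => ((0 : Fin 1), J' k)) := fun k k' hkk' => hJ' (by simpa using hkk')
  obtain ⟨t₀, hdet⟩ := fullJoin_det_ne_zero_of_threshold h 1 h r u w (fun k => ((0 : Fin 1), J' k)) he (fun _ => 0)
    (fun _ _ => 1) hthr (fun _ => tab) (fun _ => tab) (by simpa using hx) (by simpa using hy)
  refine partitionMinor_hit_of_oneCube_pow (K := h) 1 hh (by simp) u w ⟨tab, tab, fun _ => t₀ ^ (1 : ℕ), ?_⟩
  simpa using hdet

end FullJoin

end

end Summit.ValiantsHypothesis.ValiantsHypothesis.Theorems.BarrierLever.HiddenStates
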